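import Summits.BirchSwinnertonDyer.Rank1Residual.GaloisImage.TameLayerEulerCharacteristic
import Summits.BirchSwinnertonDyer.Rank1Residual.GaloisImage.EPCGaloisBaseChange
import Summits.BirchSwinnertonDyer.Rank1Residual.GaloisImage.EPCCohomologyTransport
import Literature.NumberTheory.GaloisRepresentations.KummerTwo
import Literature.NumberTheory.GaloisRepresentations.PPrimaryDevissage
import HarnessLib

/-!
# The bottom layer of the `p`-tower in Tate's theorem: Euler–Poincaré count for `Gal(K̄/E) ≤ Γ_K`
# (cell `b2b-bsdres`, team n1011, row T-EPC = Tate's local Euler–Poincaré characteristic; seat p04 GEN 8; stage D5c)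

HONEST FRAMING (cell `b2b-bsdres`, run/shared/lean/b2b/bsd-rank1-residual/, verbatim in every
file): the goal of the cell is to DELETE the COMBINATION-SHAPED residual classes of the
Birch–Swinnerton-Dyer formula for ALL analytic-rank `≤ 1` elliptic curves over `ℚ` — "full BSD
formula for every rank `≤ 1` curve in class `C`" assembled STRICTLY from published theorems — so
that the rank-`≤ 1` remainder becomes exactly the CONSTRUCTION-SHAPED classes, which are TYPED
(missing-input `Prop`s), NOT attempted. This is not "finishing BSD". Team n1011 (N10 / N11, the
additive block X4 ∧ `p = 3`): research route; no claim beyond the stated classes; nothing is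
booked; no mark / label is changed by this file. Theorems only (no definition, no named fact, no
`sorry`).  (Placement: Summits/GaloisImage with the T-EPC cone.)

## What

`EPCBottom.epc_galFixing` — let `K` be a non-archimedean local field of characteristic `0` with
`|p| < 1`, `E/K` a finite Galois subextension of `K̄`, `M` a finite discrete `Γ_K`-module killed
by `p`, and `S₀ ⊴ Γ_K` an open normal subgroup acting trivially on `M` and on `μ_p(K̄)` with
`[Gal(K̄/E) : S₀ ∩ Gal(K̄/E)]` prime to `p`.  Then `H¹`, `H²` of `Gal(K̄/E) = galFixing K E` with
values in `M` are finite and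
`#M^{Gal(K̄/E)} · #H²(Gal(K̄/E), M) · #(𝒪_K / #M)^{[E:K]} = #H¹(Gal(K̄/E), M)`.
Proof: the tame layer of Tate's theorem over the local field `E` (stage C5
`TameLayer.localEulerPoincare`, applied to `Γ_E` and the subextension of `Ē` cut out by the
pull-back of `S₀`), transported along `Γ_E ≃ₜ* Gal(K̄/E)` (stages D5a, D5b), with
`#(𝒪_E / p^r) = #(𝒪_K / p^r)^{[E:K]}` (stage B6b, normal-basis lattice count).

References: J. S. Milne, *Arithmetic Duality Theorems* (2006), I §2 Thm. 2.8 and Lemma 2.12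
[MilneADT2006]; J.-P. Serre, *Galois Cohomology* (1997), II §5.7 [SerreGaloisCohomology1997].
-/

noncomputable section

open CategoryTheory Function Field
open scoped ValuativeRel
open Literature.NumberTheory.GaloisRepresentations
open Literature.NumberTheory.GaloisRepresentations.DiscreteGaloisModule
open Literature.NumberTheory.GaloisRepresentations.LocalWeilDatum

universe u

namespace Summit.BirchSwinnertonDyer.Rank1Residual.GaloisImage

namespace EPCBottom

variable (K : Type u) [Field K] [ValuativeRel K] [TopologicalSpace K] [IsNonarchimedeanLocalField K]
  [CharZero K]
variable (p : ℕ) [hp : Fact p.Prime]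
variable (E : IntermediateField K (AlgebraicClosure K)) [FiniteDimensional K E] [IsGalois K E]
variable {M : Type u} [AddCommGroup M] [TopologicalSpace M] [DiscreteTopology M] [Finite M]

omit [AddCommGroup M] [TopologicalSpace M] [DiscreteTopology M] [Finite M] in
/-- **`#(𝒪_E / #M) = #(𝒪_K / #M)^{[E:K]}`** for `#M = p^r`, `E/K` finite Galois inside `K̄` with
its local-field structure (`FiniteExtension`): Milne's Lemma 2.12 count `#(𝒪_E/p) = #(𝒪_K/p)^{[E:K]}`
(stage B6b) and `#(R/a^r) = #(R/a)^r`. [cite: MilneADT2006, I §2 Lemma 2.12 (p. 34)] -/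
theorem natCard_integer_quotient_card (hpv : ValuativeRel.valuation K p < 1) {r : ℕ} (hr : Nat.card M = p ^ r) :
    letI := FiniteExtension.valuativeRel K E
    Nat.card (𝒪[E] ⧸ Ideal.span {((Nat.card M : ℕ) : 𝒪[E])}) =
      Nat.card (𝒪[K] ⧸ Ideal.span {((Nat.card M : ℕ) : 𝒪[K])}) ^ Module.finrank K E := by
  letI := FiniteExtension.valuativeRel K E
  letI := FiniteExtension.topologicalSpace K E
  haveI := FiniteExtension.isNonarchimedeanLocalField K E
  haveI : CharZero E := charZero_of_injective_algebraMap (algebraMap K E).injective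
  have hpvE : ValuativeRel.valuation E p < 1 := (EPCLocalField.valuation_natCast_lt_one_iff K E p).2 hpv
  obtain ⟨OK, hOK, hOK'⟩ := EPCLocalField.exists_submodule_integer K E
  have hB := LocalIntegers.natCard_integer_quotient_eq_pow p hpvE
    (fun σ x => EPCLocalField.valuation_algEquiv K E σ x) OK hOK
  rw [OneUnits.natCard_quotient_integer_eq p OK hOK'] at hB
  have haE : ∀ x : 𝒪[E], (p : 𝒪[E]) * x = 0 → x = 0 := fun x hx =>
    (mul_eq_zero.1 hx).resolve_left (by
      intro h
      have h' : ((p : 𝒪[E]) : E) = 0 := by rw [h]; rfl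
      rw [SubringClass.coe_natCast, Nat.cast_eq_zero] at h'
      exact hp.out.ne_zero h')
  have haK : ∀ x : 𝒪[K], (p : 𝒪[K]) * x = 0 → x = 0 := fun x hx =>
    (mul_eq_zero.1 hx).resolve_left (by
      intro h
      have h' : ((p : 𝒪[K]) : K) = 0 := by rw [h]; rfl
      rw [SubringClass.coe_natCast, Nat.cast_eq_zero] at h'
      exact hp.out.ne_zero h')
  rw [hr, Nat.cast_pow, Nat.cast_pow, QuotientPow.natCard_quotient_span_pow _ haE,
    QuotientPow.natCard_quotient_span_pow _ haK, hB, ← pow_mul, ← pow_mul, mul_comm]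

/-- **Bottom layer.** For `K` non-archimedean local of characteristic `0` with `|p| < 1`, `E/K`
finite Galois inside `K̄`, `M` finite discrete killed by `p`, and an open normal `S₀ ⊴ Γ_K` acting
trivially on `M` and on `μ_p(K̄)` with `[Gal(K̄/E) : S₀ ∩ Gal(K̄/E)]` prime to `p`:
`H¹(Gal(K̄/E), M)`, `H²(Gal(K̄/E), M)` are finite and
`#M^{Gal(K̄/E)} · #H²(Gal(K̄/E), M) · #(𝒪_K/#M)^{[E:K]} = #H¹(Gal(K̄/E), M)` — Tate's formula over
the local field `E` in its tame case (stage C5), moved to the subgroup `Gal(K̄/E) ≤ Γ_K`.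
[cite: MilneADT2006, I §2 Thm 2.8] [cite: SerreGaloisCohomology1997, II §5.7 Thm. 5] -/
theorem epc_galFixing (hpv : ValuativeRel.valuation K p < 1)
    (ρ : ContinuousRep (absoluteGaloisGroup K) ℤ M) (hpM : ∀ m : M, p • m = 0)
    (S₀ : Subgroup (absoluteGaloisGroup K)) [hS₀ : S₀.Normal] (hS₀o : IsOpen (S₀ : Set (absoluteGaloisGroup K)))
    (hidx : ¬ p ∣ S₀.relIndex (galFixing K E))
    (hS₀M : ∀ g ∈ S₀, ∀ m : M, ρ g m = m) (hS₀μ : ∀ g ∈ S₀, ∀ ζ : MuCarrier K p, mu K p g ζ = ζ) :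
    Finite (continuousCohomology 1 (ρ.restrict (subgroupIncl (galFixing K E))).toTopRep) ∧
    Finite (continuousCohomology 2 (ρ.restrict (subgroupIncl (galFixing K E))).toTopRep) ∧
    Nat.card (ρ.restrict (subgroupIncl (galFixing K E))).toTopRep.ρ.invariants *
        Nat.card (continuousCohomology 2 (ρ.restrict (subgroupIncl (galFixing K E))).toTopRep) *
        Nat.card (𝒪[K] ⧸ Ideal.span {((Nat.card M : ℕ) : 𝒪[K])}) ^ Module.finrank K E =
      Nat.card (continuousCohomology 1 (ρ.restrict (subgroupIncl (galFixing K E))).toTopRep) := by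
  classical
  haveI : NeZero p := ⟨hp.out.ne_zero⟩
  haveI : CharZero E := charZero_of_injective_algebraMap (algebraMap K E).injective
  -- `#M = p^r` and the integer factor
  obtain ⟨r, hr⟩ := exists_card_eq_prime_pow M (fun m => ⟨1, by rw [pow_one]; exact hpM m⟩ :
    IsPrimaryTorsion p M)
  rw [← natCard_integer_quotient_card K p E hpv hr]
  -- the local field `E`
  letI := FiniteExtension.valuativeRel K E
  letI := FiniteExtension.topologicalSpace K E
  haveI := FiniteExtension.isNonarchimedeanLocalField K E
  have hpvE : ValuativeRel.valuation E p < 1 := (EPCLocalField.valuation_natCast_lt_one_iff K E p).2 hpv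
  -- `ι : Γ_E ≃ₜ* Gal(K̄/E)` and the pulled-back module
  obtain ⟨ι, hιμ⟩ := EPCBaseChange.exists_continuousMulEquiv_galFixing K E
  let ρ₁ : ContinuousRep (absoluteGaloisGroup E) ℤ M :=
    (ρ.restrict (subgroupIncl (galFixing K E))).restrict (ι : absoluteGaloisGroup E →ₜ* galFixing K E)
  have hc : ∀ g m, ρ₁ g m = (ρ.restrict (subgroupIncl (galFixing K E))) (ι g) m := fun _ _ => rfl
  -- the open normal subgroup `U₁ = ι⁻¹(S₀ ∩ Gal(K̄/E))` and its fixed field `E₁`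
  set U₁ : Subgroup (absoluteGaloisGroup E) :=
    (S₀.subgroupOf (galFixing K E)).comap (ι : absoluteGaloisGroup E →* galFixing K E) with hU₁
  have hmemU₁ : ∀ g, g ∈ U₁ ↔ ((ι g : galFixing K E) : absoluteGaloisGroup K) ∈ S₀ := fun g => by
    rw [hU₁, Subgroup.mem_comap, Subgroup.mem_subgroupOf]; rfl
  haveI hU₁n : U₁.Normal := Subgroup.Normal.comap (hS₀.subgroupOf _) _
  have hU₁o : IsOpen (U₁ : Set (absoluteGaloisGroup E)) :=
    ((hS₀o.preimage continuous_subtype_val).preimage ι.continuous)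
  have hU₁idx : U₁.index = S₀.relIndex (galFixing K E) :=
    Subgroup.index_comap_of_surjective _ ι.surjective
  obtain ⟨E₁, hE₁fd, hE₁⟩ := exists_galFixing_eq_of_isOpen U₁ hU₁o
  haveI := hE₁fd
  haveI : (galFixing (↥E) E₁).Normal := by rw [hE₁]; exact hU₁n
  haveI : IsGalois (↥E) E₁ := EPCBaseChange.isGalois_of_normal_galFixing (↥E) E₁
  -- hypotheses of the tame layer over `E`
  have hG : ¬ p ∣ (galFixing (↥E) E₁).index := by rwa [hE₁, hU₁idx]
  have hμ : ∀ g ∈ galFixing (↥E) E₁, ∀ ζ : MuCarrier (↥E) p, mu (↥E) p g ζ = ζ := by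
    intro g hg
    rw [hE₁, hmemU₁] at hg
    exact hιμ p g (fun ζ => hS₀μ _ hg ζ)
  have hNM : ∀ g ∈ galFixing (↥E) E₁, ∀ m : M, ρ₁ g m = m := by
    intro g hg m
    rw [hE₁, hmemU₁] at hg
    exact hS₀M _ hg m
  obtain ⟨hf1, hf2, hcount⟩ := TameLayer.localEulerPoincare (↥E) p E₁ ρ₁ hpvE hG hμ hpM hNM
  -- transport along `ι`
  rw [EPCTransport.natCard_continuousCohomology_congr ι _ _ hc 1,
    EPCTransport.natCard_continuousCohomology_congr ι _ _ hc 2,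
    EPCTransport.natCard_invariants_congr ι _ _ hc] at hcount
  exact ⟨(EPCTransport.finite_continuousCohomology_iff ι _ _ hc 1).1 hf1,
    (EPCTransport.finite_continuousCohomology_iff ι _ _ hc 2).1 hf2, hcount⟩

end EPCBottom

end Summit.BirchSwinnertonDyer.Rank1Residual.GaloisImage

end
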